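import Summits.ValiantsHypothesis.ValiantsHypothesis.Theorems.LacunarySymmetroidMatrixDescartesDefectDefs

/-!
# `MatrixDescartes` — line «defect» ported (1/·): the DEFECT RANGE LAW
# `√|c₀·lc| · (2cos(φ/2))^{Z} · (sin(φ/D)/√2)^D ≤ ‖f‖₁` for real polynomials with `Z` positive roots and defect `D ≥ 1`

HONEST FRAMING.  Port (val-lit desk g11 pool; porter val-port-1) of §1–§4 of the crux workfile
`Cruxes/MatrixDescartes/Lines/defect.lean` v2.1 (val-idea-6 g4, LINE 3, lens «assume the law fails» + control quantity;
val-idea-crit-1 VERDICT #25 = PASS, structure + instrument tier, 0 seats; all 13 rows reproduced exactly by the critic).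
The crux `Summit.ValiantsHypothesis.ValiantsHypothesis.Theses.LacunarySymmetroid.MatrixDescartes` (`stmt-ValiantsHypothesis-18050`)
is asymptotic in `K` and HEIGHT-FREE; the defect law is height-sensitive and locates violators (non-full, many wasted
roots) without bounding their degree, so NOTHING here closes the crux, moves a census rung of record, or bears on
`VP ≠ VNP`.  Vocabulary by name: `l1` (`…FiniteSectorHeightDefs`), `arc`, `node` (`…DefectDefs`).  No `Theses` import.

THE FIRST HEIGHT LAW OFF THE FULL SECTOR.  Lines «range»/«profile» (`…RangeLaw`, `…ProfileLaw`) price positive roots of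
FULL pencils at one bit each.  Off the full sector the law is made DEGREE-AWARE through the DEFECT `D := deg f − Z₊`
(the number of wasted = non-positive-real roots): positive roots still cost a fixed number of bits each, and each wasted
root REFUNDS a bounded number of bits.

* **§1 complex evaluation tools** (`norm_multiset_prod_map`, `norm_eval_eq_prod`, `norm_coeff_zero_eq_prod`,
  `norm_eval_map_le_l1`; the workfile's `l1_nonneg` is the tree's `…RangeObligations.l1_nonneg`, val-port-4, not re-declared): `‖g(z)‖ = ‖lc‖·Π‖z−γ‖`, `‖c₀‖ = ‖lc‖·Π‖γ‖`, and `‖f(z)‖ ≤ ‖f‖₁` on the closed unit disc.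
* **§2 geometry on the unit circle** (`norm_arc`, `norm_arc_sub_real_sq`, `two_sqrt_mul_cos_le_norm_arc_sub`,
  `norm_arc_sub_arc`, `sigma_sqrt_le_norm_sub`): on the arc `|θ−π| ≤ φ` a positive real `α` is seen at distance
  `≥ 2√α·cos(φ/2)`; a point at distance `≥ σ` from `β` is at distance `≥ (σ/√2)·√‖β‖`.
* **§3 pigeonhole on the arc** (`multiset_prod_map_le`, `multiset_prod_map_nonneg`, `exists_far_point`, `node_mem`,
  `node_sep`): among `D+1` nodes spaced `≥ 2sin(φ/D)` apart one is `≥ sin(φ/D)` from all `D` wasted roots.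
* **§4 THE DEFECT RANGE LAW** (`defectLaw`): for every real `f ≠ 0`, any finset `A` of positive roots, defect
  `D = deg f − |A| ≥ 1`, `0 < φ ≤ π/2`:  `√|a_0·a_N| · (2cos(φ/2))^{|A|} · (sin(φ/D)/√2)^D ≤ ‖f‖₁`
  (`D = 0` is the full case `2^{|A|}√|a_0 a_N| ≤ ‖f‖₁` of line «range», `…Range.rangeLaw_fullPos_l1`).
The pencil form, the census rows and the excess law are `…DefectLawPencil.lean`; STUB 1 (interpolation law) and its rows
follow in the §8–§10 port files.  [folklore] throughout (factorisation over `ℂ`, chord lengths, pigeonhole).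
-/

-- `Summit.ValiantsHypothesis.ValiantsHypothesis.…` repeats a component by the D-0017 layout
-- (single-conjunct summit), which the `dupNamespace` linter flags; the name is mandated.
set_option linter.dupNamespace false

noncomputable section

open Polynomial Finset

namespace Summit.ValiantsHypothesis.ValiantsHypothesis.Theorems.LacunarySymmetroidMatrixDescartes.Defect

open Summit.ValiantsHypothesis.ValiantsHypothesis.Theorems.LacunarySymmetroidMatrixDescartes.FiniteSector

/-! ## §1 Complex evaluation tools -/

/-- The norm of a multiset product is the product of the norms. [folklore] -/
theorem norm_multiset_prod_map {ι : Type*} (s : Multiset ι) (f : ι → ℂ) :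
    ‖(s.map f).prod‖ = (s.map (fun i => ‖f i‖)).prod := by
  induction s using Multiset.induction_on with
  | empty => simp
  | cons a s ih => simp [ih]

/-- `‖g(z)‖ = ‖lc‖ · Π_{roots γ} ‖z − γ‖` over `ℂ`. [folklore] -/
theorem norm_eval_eq_prod (g : ℂ[X]) (z : ℂ) :
    ‖g.eval z‖ = ‖g.leadingCoeff‖ * (g.roots.map (fun γ => ‖z - γ‖)).prod := by
  rw [(IsAlgClosed.splits g).eval_eq_prod_roots z, norm_mul, norm_multiset_prod_map]

/-- `‖coeff 0‖ = ‖lc‖ · Π ‖γ‖` over `ℂ`. [folklore] -/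
theorem norm_coeff_zero_eq_prod (g : ℂ[X]) :
    ‖g.coeff 0‖ = ‖g.leadingCoeff‖ * (g.roots.map (fun γ => ‖γ‖)).prod := by
  rw [coeff_zero_eq_eval_zero, norm_eval_eq_prod]
  simp

/-- On the closed unit disc `‖f(z)‖ ≤ ‖f‖₁`. [folklore] -/
theorem norm_eval_map_le_l1 (f : ℝ[X]) {z : ℂ} (hz : ‖z‖ ≤ 1) :
    ‖(f.map Complex.ofRealHom).eval z‖ ≤ l1 f := by
  rw [eval_eq_sum_range, natDegree_map_eq_of_injective (f := Complex.ofRealHom) Complex.ofReal_injective]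
  refine (norm_sum_le _ _).trans (Finset.sum_le_sum (fun i _ => ?_))
  rw [coeff_map, norm_mul, norm_pow, Complex.ofRealHom_eq_coe, Complex.norm_real, Real.norm_eq_abs]
  exact mul_le_of_le_one_right (abs_nonneg _) (pow_le_one₀ (norm_nonneg _) hz)

/-! ## §2 Geometry on the unit circle (`…DefectDefs.arc`) -/

/-- Arc points lie on the unit circle. [folklore] -/
theorem norm_arc (θ : ℝ) : ‖arc θ‖ = 1 := by
  simp [arc, Complex.norm_exp]

/-- `‖e^{iθ} − α‖² = 1 + α² − 2α cos θ` for real `α`. [folklore] -/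
theorem norm_arc_sub_real_sq (θ α : ℝ) : ‖arc θ - α‖ ^ 2 = 1 + α ^ 2 - 2 * α * Real.cos θ := by
  rw [Complex.sq_norm, Complex.normSq_apply]
  have hre : (arc θ - α).re = Real.cos θ - α := by
    simp [arc, Complex.exp_ofReal_mul_I_re]
  have him : (arc θ - α).im = Real.sin θ := by
    simp [arc, Complex.exp_ofReal_mul_I_im]
  rw [hre, him]
  nlinarith [Real.sin_sq_add_cos_sq θ]

/-- On the arc `|θ − π| ≤ φ ≤ π`, a positive real `α` is seen at distance `≥ 2√α·cos(φ/2)`. [folklore] -/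
theorem two_sqrt_mul_cos_le_norm_arc_sub {θ φ α : ℝ} (hα : 0 < α) (hφ0 : 0 ≤ φ) (hφ : φ ≤ Real.pi)
    (hθ : |θ - Real.pi| ≤ φ) : 2 * Real.sqrt α * Real.cos (φ / 2) ≤ ‖arc θ - α‖ := by
  have hcosθ : Real.cos θ ≤ - Real.cos φ := by
    have h1 : Real.cos φ ≤ Real.cos |θ - Real.pi| :=
      Real.cos_le_cos_of_nonneg_of_le_pi (abs_nonneg _) hφ hθ
    rw [Real.cos_abs, Real.cos_sub_pi] at h1
    linarith
  have hc2 : 0 ≤ Real.cos (φ / 2) := Real.cos_nonneg_of_neg_pi_div_two_le_of_le (by linarith) (by linarith)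
  have hlhs : 0 ≤ 2 * Real.sqrt α * Real.cos (φ / 2) := by positivity
  rw [← pow_le_pow_iff_left₀ hlhs (norm_nonneg _) two_ne_zero, norm_arc_sub_real_sq]
  have hsq : (2 * Real.sqrt α * Real.cos (φ / 2)) ^ 2 = 4 * α * Real.cos (φ / 2) ^ 2 := by
    rw [mul_pow, mul_pow, Real.sq_sqrt hα.le]; ring
  have hcs : Real.cos (φ / 2) ^ 2 = 1 / 2 + Real.cos φ / 2 := by
    rw [Real.cos_sq]; ring_nf
  rw [hsq, hcs]
  nlinarith [sq_nonneg (1 - α), mul_le_mul_of_nonneg_left hcosθ (by linarith : (0:ℝ) ≤ 2 * α)]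

/-- Chord length: `‖e^{iθ} − e^{iθ'}‖ = 2|sin((θ−θ')/2)|`. [folklore] -/
theorem norm_arc_sub_arc (θ θ' : ℝ) : ‖arc θ - arc θ'‖ = 2 * |Real.sin ((θ - θ') / 2)| := by
  have h : arc θ - arc θ' = arc θ' * (Complex.exp (Complex.I * (θ - θ' : ℝ)) - 1) := by
    rw [mul_sub, mul_one, arc, arc, ← Complex.exp_add]
    congr 2
    push_cast
    ring
  rw [h, norm_mul, norm_arc, one_mul, Complex.norm_exp_I_mul_ofReal_sub_one, Real.norm_eq_abs, abs_mul,
    abs_two]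

/-- For a point of the unit circle at distance `≥ σ` (`σ ≤ 1`) from `β`, in fact `‖z − β‖ ≥ (σ/√2)·√‖β‖`. [folklore] -/
theorem sigma_sqrt_le_norm_sub {z β : ℂ} (hz : ‖z‖ = 1) {σ : ℝ} (hσ0 : 0 ≤ σ) (hσ1 : σ ≤ 1)
    (h : σ ≤ ‖z - β‖) : σ / Real.sqrt 2 * Real.sqrt ‖β‖ ≤ ‖z - β‖ := by
  by_cases hb : ‖β‖ ≤ 2
  · -- √‖β‖ ≤ √2
    have h1 : Real.sqrt ‖β‖ ≤ Real.sqrt 2 := Real.sqrt_le_sqrt hb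
    have h2 : 0 < Real.sqrt 2 := by positivity
    calc σ / Real.sqrt 2 * Real.sqrt ‖β‖ ≤ σ / Real.sqrt 2 * Real.sqrt 2 :=
          mul_le_mul_of_nonneg_left h1 (by positivity)
      _ = σ := by field_simp
      _ ≤ ‖z - β‖ := h
  · rw [not_le] at hb
    -- ‖z − β‖ ≥ ‖β‖ − 1 ≥ √(‖β‖/2) ≥ (σ/√2)√‖β‖
    have h1 : ‖β‖ - 1 ≤ ‖z - β‖ := by
      have := norm_sub_norm_le β z
      rw [hz, norm_sub_rev] at this
      linarith
    have h3 : Real.sqrt ‖β‖ ≤ Real.sqrt 2 * (‖β‖ - 1) := by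
      rw [← pow_le_pow_iff_left₀ (Real.sqrt_nonneg _) (mul_nonneg (Real.sqrt_nonneg _) (by linarith)) two_ne_zero, mul_pow,
        Real.sq_sqrt (norm_nonneg _), Real.sq_sqrt (by norm_num : (0:ℝ) ≤ 2)]
      nlinarith
    have h2 : 0 < Real.sqrt 2 := by positivity
    calc σ / Real.sqrt 2 * Real.sqrt ‖β‖ ≤ 1 / Real.sqrt 2 * (Real.sqrt 2 * (‖β‖ - 1)) :=
          mul_le_mul (div_le_div_of_nonneg_right hσ1 h2.le) h3 (Real.sqrt_nonneg _) (by positivity)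
      _ = ‖β‖ - 1 := by field_simp
      _ ≤ ‖z - β‖ := h1

/-! ## §3 Pigeonhole on the arc (`…DefectDefs.node`) -/

/-- Products over a multiset are monotone in nonnegative factors. [folklore] -/
theorem multiset_prod_map_le {ι : Type*} (s : Multiset ι) (f g : ι → ℝ) (h0 : ∀ i ∈ s, 0 ≤ f i)
    (h : ∀ i ∈ s, f i ≤ g i) : (s.map f).prod ≤ (s.map g).prod := by
  induction s using Multiset.induction_on with
  | empty => simp
  | cons a s ih =>
    simp only [Multiset.map_cons, Multiset.prod_cons]
    have ha0 := h0 a (Multiset.mem_cons_self a s)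
    have hs0 : 0 ≤ (s.map f).prod :=
      Multiset.prod_nonneg (fun x hx => by
        obtain ⟨i, hi, rfl⟩ := Multiset.mem_map.1 hx
        exact h0 i (Multiset.mem_cons_of_mem hi))
    exact mul_le_mul (h a (Multiset.mem_cons_self a s))
      (ih (fun i hi => h0 i (Multiset.mem_cons_of_mem hi)) (fun i hi => h i (Multiset.mem_cons_of_mem hi)))
      hs0 (ha0.trans (h a (Multiset.mem_cons_self a s)))

/-- A multiset product of nonnegative factors is nonnegative. [folklore] -/
theorem multiset_prod_map_nonneg {ι : Type*} (s : Multiset ι) (f : ι → ℝ) (h0 : ∀ i ∈ s, 0 ≤ f i) :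
    0 ≤ (s.map f).prod :=
  Multiset.prod_nonneg (fun x hx => by
    obtain ⟨i, hi, rfl⟩ := Multiset.mem_map.1 hx
    exact h0 i hi)

/-- If `D + 1` points are pairwise `≥ s` apart, one of them is `≥ s/2` away from every element of a
multiset of cardinality `≤ D`. [folklore: pigeonhole] -/
theorem exists_far_point {D : ℕ} (B : Multiset ℂ) (hB : B.card ≤ D) (z : Fin (D + 1) → ℂ) {s : ℝ}
    (hsep : ∀ i j, i ≠ j → s ≤ ‖z i - z j‖) : ∃ i, ∀ β ∈ B, s / 2 ≤ ‖z i - β‖ := by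
  by_contra hcon
  simp only [not_exists, not_forall, not_le, exists_prop] at hcon
  choose β hβB hβlt using hcon
  have hcard : B.toFinset.card < (Finset.univ : Finset (Fin (D + 1))).card := by
    rw [Finset.card_univ, Fintype.card_fin]
    exact lt_of_le_of_lt ((Multiset.toFinset_card_le B).trans hB) (Nat.lt_succ_self D)
  obtain ⟨i, -, j, -, hij, hβeq⟩ := Finset.exists_ne_map_eq_of_card_lt_of_maps_to hcard
    (f := β) (fun i _ => Multiset.mem_toFinset.2 (hβB i))
  have h1 := hsep i j hij
  have h2 : ‖z i - z j‖ < s := by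
    calc ‖z i - z j‖ = ‖(z i - β i) - (z j - β j)‖ := by rw [hβeq]; congr 1; ring
      _ ≤ ‖z i - β i‖ + ‖z j - β j‖ := norm_sub_le _ _
      _ < s / 2 + s / 2 := add_lt_add (hβlt i) (hβlt j)
      _ = s := by ring
  linarith

/-- The nodes lie on the arc `|θ − π| ≤ φ`. [folklore] -/
theorem node_mem {φ : ℝ} (hφ0 : 0 ≤ φ) {D : ℕ} (hD : 1 ≤ D) (i : Fin (D + 1)) :
    |node φ D i - Real.pi| ≤ φ := by
  have hi : ((i : ℕ) : ℝ) ≤ D := by exact_mod_cast Nat.lt_succ_iff.1 i.isLt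
  have hD' : (0 : ℝ) < D := by exact_mod_cast hD
  rw [abs_le]
  constructor
  · have : 0 ≤ 2 * φ / D * (i : ℕ) := by positivity
    simp only [node]; linarith
  · simp only [node]
    have : 2 * φ / D * (i : ℕ) ≤ 2 * φ / D * D := mul_le_mul_of_nonneg_left hi (by positivity)
    rw [div_mul_cancel₀ _ hD'.ne'] at this
    linarith

/-- Distinct nodes are `≥ 2 sin(φ/D)` apart (for `0 ≤ φ ≤ π/2`). [folklore] -/
theorem node_sep {φ : ℝ} (hφ0 : 0 ≤ φ) (hφ : φ ≤ Real.pi / 2) {D : ℕ} (hD : 1 ≤ D)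
    (i j : Fin (D + 1)) (hij : i ≠ j) :
    2 * Real.sin (φ / D) ≤ ‖arc (node φ D i) - arc (node φ D j)‖ := by
  rw [norm_arc_sub_arc]
  have hD' : (0 : ℝ) < D := by exact_mod_cast hD
  -- (node i − node j)/2 = φ (i − j)/D
  have hdiff : (node φ D i - node φ D j) / 2 = φ / D * ((i : ℕ) - (j : ℕ) : ℝ) := by
    simp only [node]; field_simp; ring
  rw [hdiff]
  -- let k = |i - j| ≥ 1, ≤ D
  have hk1 : (1 : ℝ) ≤ |((i : ℕ) : ℝ) - ((j : ℕ) : ℝ)| := by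
    have : (i : ℕ) ≠ (j : ℕ) := fun h => hij (Fin.ext h)
    rcases lt_or_gt_of_ne this with h | h
    · rw [abs_of_neg (by exact_mod_cast (by omega : (i:ℤ) - j < 0) : ((i : ℕ) : ℝ) - ((j : ℕ) : ℝ) < 0)]
      have : ((i : ℕ) : ℝ) + 1 ≤ ((j : ℕ) : ℝ) := by exact_mod_cast h
      linarith
    · rw [abs_of_pos (by exact_mod_cast (by omega : (0:ℤ) < (i:ℤ) - j) : (0:ℝ) < ((i : ℕ) : ℝ) - ((j : ℕ) : ℝ))]
      have : ((j : ℕ) : ℝ) + 1 ≤ ((i : ℕ) : ℝ) := by exact_mod_cast h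
      linarith
  have hkD : |((i : ℕ) : ℝ) - ((j : ℕ) : ℝ)| ≤ D := by
    have hi : ((i : ℕ) : ℝ) ≤ D := by exact_mod_cast Nat.lt_succ_iff.1 i.isLt
    have hj : ((j : ℕ) : ℝ) ≤ D := by exact_mod_cast Nat.lt_succ_iff.1 j.isLt
    have hi0 : (0 : ℝ) ≤ ((i : ℕ) : ℝ) := by positivity
    have hj0 : (0 : ℝ) ≤ ((j : ℕ) : ℝ) := by positivity
    rw [abs_le]; constructor <;> linarith
  rw [Real.abs_sin_eq_sin_abs_of_abs_le_pi ?_, abs_mul, abs_of_nonneg (by positivity : (0:ℝ) ≤ φ / D)]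
  · refine mul_le_mul_of_nonneg_left ?_ (by norm_num)
    apply Real.sin_le_sin_of_le_of_le_pi_div_two
    · have : 0 ≤ φ / D := by positivity
      linarith
    · calc φ / D * |((i : ℕ) : ℝ) - ((j : ℕ) : ℝ)| ≤ φ / D * D := mul_le_mul_of_nonneg_left hkD (by positivity)
        _ = φ := div_mul_cancel₀ _ hD'.ne'
        _ ≤ Real.pi / 2 := hφ
    · calc φ / D = φ / D * 1 := (mul_one _).symm
        _ ≤ φ / D * |((i : ℕ) : ℝ) - ((j : ℕ) : ℝ)| := mul_le_mul_of_nonneg_left hk1 (by positivity)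
  · rw [abs_mul, abs_of_nonneg (by positivity : (0:ℝ) ≤ φ / D)]
    calc φ / D * |((i : ℕ) : ℝ) - ((j : ℕ) : ℝ)| ≤ φ / D * D := mul_le_mul_of_nonneg_left hkD (by positivity)
      _ = φ := div_mul_cancel₀ _ hD'.ne'
      _ ≤ Real.pi := by linarith [Real.pi_pos]

/-! ## §4 THE DEFECT RANGE LAW: positive roots cost a bit each unless paid for by defect -/

/-- **Defect range law (real polynomials).**  Let `f ≠ 0` have the distinct positive roots `A` (any finset of
them) and DEFECT `D = deg f − |A| ≥ 1` (the number of remaining complex roots, with multiplicity).  Then for every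
`0 < φ ≤ π/2`:  `√|a_0·a_N| · (2cos(φ/2))^{|A|} · (sin(φ/D)/√2)^D ≤ ‖f‖₁`.
(`D = 0` is the full case `2^{|A|}√|a_0 a_N| ≤ ‖f‖₁` of line «range», the limit `φ → 0`.)  Proof: evaluate `f` at the
node of the arc `|θ − π| ≤ φ` that is `≥ sin(φ/D)` away from all `D` remaining roots (pigeonhole over `D+1` nodes).
[folklore] -/
theorem defectLaw (f : ℝ[X]) (hf : f ≠ 0) (A : Finset ℝ) (hApos : ∀ a ∈ A, 0 < a)
    (hAroot : ∀ a ∈ A, f.IsRoot a) {D : ℕ} (hD : f.natDegree = A.card + D) (hD1 : 1 ≤ D)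
    {φ : ℝ} (hφ0 : 0 < φ) (hφ : φ ≤ Real.pi / 2) :
    Real.sqrt |f.coeff 0 * f.leadingCoeff| * ((2 * Real.cos (φ / 2)) ^ A.card
      * (Real.sin (φ / D) / Real.sqrt 2) ^ D) ≤ l1 f := by
  -- complexification
  set g : ℂ[X] := f.map Complex.ofRealHom with hg
  have hg0 : g ≠ 0 := (Polynomial.map_ne_zero_iff Complex.ofReal_injective).2 hf
  have hgdeg : g.natDegree = f.natDegree := natDegree_map_eq_of_injective Complex.ofReal_injective f
  have hglc : g.leadingCoeff = (f.leadingCoeff : ℂ) := leadingCoeff_map_of_injective Complex.ofReal_injective f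
  have hgc0 : g.coeff 0 = (f.coeff 0 : ℂ) := coeff_map _ _
  set R := g.roots with hR
  have hRcard : R.card = A.card + D := by
    rw [hR, ← (IsAlgClosed.splits g).natDegree_eq_card_roots, hgdeg, hD]
  -- the positive roots sit inside R
  set A' : Multiset ℂ := A.val.map (fun a : ℝ => (a : ℂ)) with hA'
  have hA'le : A' ≤ R := by
    have h1 : A.val ≤ f.roots :=
      (Multiset.le_iff_subset A.nodup).2 (fun a ha => (mem_roots hf).2 (hAroot a ha))
    have h2 : A.val.map (fun a : ℝ => (a : ℂ)) ≤ f.roots.map (fun a : ℝ => (a : ℂ)) := Multiset.map_le_map h1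
    have h3 : f.roots.map (fun a : ℝ => (a : ℂ)) ≤ g.roots := by
      have := map_roots_le (f := Complex.ofRealHom) (p := f) hg0
      simpa using this
    exact h2.trans h3
  obtain ⟨B, hRB⟩ := Multiset.le_iff_exists_add.1 hA'le
  have hBcard : B.card = D := by
    have := congrArg Multiset.card hRB
    rw [Multiset.card_add, hRcard, hA', Multiset.card_map, Finset.card_val] at this
    omega
  -- the good node
  have hD' : (0 : ℝ) < D := by exact_mod_cast hD1
  have hσ0 : 0 ≤ Real.sin (φ / D) :=
    Real.sin_nonneg_of_nonneg_of_le_pi (by positivity)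
      (by calc φ / D ≤ φ / 1 := div_le_div_of_nonneg_left hφ0.le one_pos (by exact_mod_cast hD1)
            _ ≤ Real.pi := by linarith [Real.pi_pos])
  have hσ1 : Real.sin (φ / D) ≤ 1 := Real.sin_le_one _
  obtain ⟨i, hi⟩ := exists_far_point B hBcard.le (fun i => arc (node φ D i))
    (s := 2 * Real.sin (φ / D)) (fun i j hij => node_sep hφ0.le hφ hD1 i j hij)
  have hi' : ∀ β ∈ B, Real.sin (φ / D) ≤ ‖arc (node φ D i) - β‖ := fun β hβ => by
    have := hi β hβ; linarith
  set z := arc (node φ D i) with hz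
  have hz1 : ‖z‖ = 1 := norm_arc _
  -- evaluate
  have hev : ‖g.eval z‖ = ‖g.leadingCoeff‖ * ((A'.map (fun γ => ‖z - γ‖)).prod * (B.map (fun γ => ‖z - γ‖)).prod) := by
    rw [norm_eval_eq_prod, ← hR, hRB, Multiset.map_add, Multiset.prod_add]
  have hc0 : ‖g.coeff 0‖ = ‖g.leadingCoeff‖ * ((A'.map (fun γ => ‖γ‖)).prod * (B.map (fun γ => ‖γ‖)).prod) := by
    rw [norm_coeff_zero_eq_prod, ← hR, hRB, Multiset.map_add, Multiset.prod_add]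
  -- the A-part
  have hAprod : (A'.map (fun γ => ‖z - γ‖)).prod = ∏ a ∈ A, ‖z - (a : ℂ)‖ := by
    rw [hA', Multiset.map_map]; rfl
  have hAnorm : (A'.map (fun γ => ‖γ‖)).prod = ∏ a ∈ A, a := by
    rw [hA', Multiset.map_map]
    change (A.val.map (fun a : ℝ => ‖(a : ℂ)‖)).prod = ∏ a ∈ A, a
    have : ∀ a ∈ A, ‖(a : ℂ)‖ = a := fun a ha => by
      rw [Complex.norm_real, Real.norm_eq_abs, abs_of_pos (hApos a ha)]
    calc (A.val.map (fun a : ℝ => ‖(a : ℂ)‖)).prod = ∏ a ∈ A, ‖(a : ℂ)‖ := rfl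
      _ = ∏ a ∈ A, a := Finset.prod_congr rfl this
  have hAlow : (2 * Real.cos (φ / 2)) ^ A.card * ∏ a ∈ A, Real.sqrt a ≤ ∏ a ∈ A, ‖z - (a : ℂ)‖ := by
    rw [← Finset.prod_const, ← Finset.prod_mul_distrib]
    refine Finset.prod_le_prod (fun a ha => ?_) (fun a ha => ?_)
    · have : 0 ≤ Real.cos (φ / 2) := Real.cos_nonneg_of_neg_pi_div_two_le_of_le (by linarith) (by linarith)
      positivity
    · calc 2 * Real.cos (φ / 2) * Real.sqrt a = 2 * Real.sqrt a * Real.cos (φ / 2) := by ring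
        _ ≤ ‖z - (a : ℂ)‖ := two_sqrt_mul_cos_le_norm_arc_sub (hApos a ha) hφ0.le (by linarith)
            (node_mem hφ0.le hD1 i)
  -- the B-part
  have hBlow : (Real.sin (φ / D) / Real.sqrt 2) ^ D * (B.map (fun γ => Real.sqrt ‖γ‖)).prod
      ≤ (B.map (fun γ => ‖z - γ‖)).prod := by
    have h1 : (B.map (fun γ => Real.sin (φ / D) / Real.sqrt 2 * Real.sqrt ‖γ‖)).prod
        ≤ (B.map (fun γ => ‖z - γ‖)).prod :=
      multiset_prod_map_le B _ _ (fun γ _ => by positivity)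
        (fun γ hγ => sigma_sqrt_le_norm_sub hz1 hσ0 hσ1 (hi' γ hγ))
    rw [Multiset.prod_map_mul, Multiset.map_const', Multiset.prod_replicate, hBcard] at h1
    exact h1
  -- the square-root bookkeeping: X := ‖lc‖ Π√a Π√‖β‖ has X² = ‖lc‖‖c₀‖ = |a_0 a_N|
  set X := ‖g.leadingCoeff‖ * ((∏ a ∈ A, Real.sqrt a) * (B.map (fun γ => Real.sqrt ‖γ‖)).prod) with hX
  have hX0 : 0 ≤ X := by
    have : 0 ≤ (B.map (fun γ => Real.sqrt ‖γ‖)).prod := multiset_prod_map_nonneg B _ (fun _ _ => Real.sqrt_nonneg _)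
    positivity
  have hXsq : X ^ 2 = |f.coeff 0 * f.leadingCoeff| := by
    have h1 : (∏ a ∈ A, Real.sqrt a) ^ 2 = ∏ a ∈ A, a := by
      rw [← Finset.prod_pow]
      exact Finset.prod_congr rfl (fun a ha => Real.sq_sqrt (hApos a ha).le)
    have h2 : ((B.map (fun γ => Real.sqrt ‖γ‖)).prod) ^ 2 = (B.map (fun γ => ‖γ‖)).prod := by
      rw [← Multiset.prod_map_pow]
      congr 1
      exact Multiset.map_congr rfl (fun γ _ => Real.sq_sqrt (norm_nonneg _))
    have h3 : |f.coeff 0 * f.leadingCoeff| = ‖g.coeff 0‖ * ‖g.leadingCoeff‖ := by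
      rw [hgc0, hglc, Complex.norm_real, Complex.norm_real, Real.norm_eq_abs, Real.norm_eq_abs, abs_mul]
    rw [h3, hc0, hAnorm, hX, mul_pow, mul_pow, h1, h2]
    ring
  have hXroot : Real.sqrt |f.coeff 0 * f.leadingCoeff| = X := by
    rw [← hXsq, Real.sqrt_sq hX0]
  -- assemble
  have hcos0 : 0 ≤ 2 * Real.cos (φ / 2) := by
    have : 0 ≤ Real.cos (φ / 2) := Real.cos_nonneg_of_neg_pi_div_two_le_of_le (by linarith) (by linarith)
    positivity
  calc Real.sqrt |f.coeff 0 * f.leadingCoeff| * ((2 * Real.cos (φ / 2)) ^ A.card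
          * (Real.sin (φ / D) / Real.sqrt 2) ^ D)
      = ‖g.leadingCoeff‖ * (((2 * Real.cos (φ / 2)) ^ A.card * ∏ a ∈ A, Real.sqrt a)
          * ((Real.sin (φ / D) / Real.sqrt 2) ^ D * (B.map (fun γ => Real.sqrt ‖γ‖)).prod)) := by
        rw [hXroot, hX]; ring
    _ ≤ ‖g.leadingCoeff‖ * ((∏ a ∈ A, ‖z - (a : ℂ)‖) * (B.map (fun γ => ‖z - γ‖)).prod) := by
        refine mul_le_mul_of_nonneg_left (mul_le_mul hAlow hBlow ?_ ?_) (norm_nonneg _)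
        · have : 0 ≤ (B.map (fun γ => Real.sqrt ‖γ‖)).prod :=
            multiset_prod_map_nonneg B _ (fun _ _ => Real.sqrt_nonneg _)
          positivity
        · exact Finset.prod_nonneg (fun _ _ => norm_nonneg _)
    _ = ‖g.eval z‖ := by rw [hev, hAprod]
    _ ≤ l1 f := norm_eval_map_le_l1 f hz1.le

end Summit.ValiantsHypothesis.ValiantsHypothesis.Theorems.LacunarySymmetroidMatrixDescartes.Defect

end
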